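import Literature.NumberTheory.Automorphic.AsaiSign
import HarnessLib

/-!
# The sign pin (stub `stub_signPin`, the lever of line `one-transparent-pane`; crux
# `Summit.Langlands.Langlands.Theses.QuadraticWindow.HostInducedRep`, stmt-Langlands-10902)

LOG (lead, 2026-08-16).  The stub is the archimedean shadow of Mok's endoscopic classification: a
conjugate self-dual cuspidal `P` on `GL_N(𝔸_E)` with Asai sign `κ` has, at every place `v` of `F`
inert in `E`, a local parameter factoring through the `L`-embedding `ξ_{χ_κ}` (Mok, Thm. 2.4.10), hence
conjugate self-dual of parity `(-1)^{N-1} κ` (Mok, Lemma 2.2.1); at a complex place `σ` over a real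
place of `F` (`E_v = ℂ`, `F_v = ℝ`, `c` acting as complex conjugation: `IsConj σ c`) with a
MULTIPLICITY-FREE parameter `z ↦ diag((z/z̄)^{a_i})` (the shape forced by `(χ σ).Nodup` and
"all `a_i` in one real coset", see the docstring of the fact) the parity is unique (Mok, Remark 2.2.2)
and is computed by `φ(-1) = (-1)^{2a_i}` (Mok, (2.2.6)): this is Mok's Example 2.5.? / Corollary 2.5.5
(arXiv Cor. 2.22: the case `a_i ∈ (N+1)/2 + ℤ`, concluding `κ = +1`), and the same four printed
ingredients give the coset form below.  No piece of this is provable in the tree today (no local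
Langlands parameters for `GL_N(ℂ)`-components of automorphic data, no endoscopic classification):
it is vendored as ONE named fact `Mok2014_archimedean_parity_of_asaiSign` (stated in the tree's
vocabulary: `HasAsaiSign`, `HasArchParameter`, `ComplexEmbedding.IsConj`), from which the registered
stub follows verbatim.  Typed-currency note (Disproof.lean §13, `Negative/AsaiSignHazard.lean`): the
tree's `HasAsaiSign` is the RAW partial-Euler-product rendering; as a HYPOTHESIS this makes the fact
weaker than the printed statement (a raw pole near `1⁺` forces absolute convergence of the product on
`Re s > 1`, hence agreement with the continued Asai `L`-function there), so the rendering is faithful.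
The refuters' mutation audit (DrefuteReport §2B) shows `(χ σ).Nodup` is NECESSARY (witness: the base
change to an imaginary quadratic field of the Maass form of Dedekind's totally real `Q₈`-field:
exponents `{0, 0}`, `κ = +1`).
-/

open scoped NumberField
open NumberField IsDedekindDomain

-- The named fact `Mok2014_archimedean_parity_of_asaiSign` stated here in v1 was RELOCATED by the gate and LANDED
-- as p114673 in `Literature/NumberTheory/Automorphic/AsaiSign.lean` (imported above).


open Literature.NumberTheory.Automorphic Literature.NumberTheory.GaloisRepresentations

set_option linter.dupNamespace false -- project-wide option (lakefile weak.linter.dupNamespace); `Summit.Langlands.Langlands` is the mandated namespace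

namespace Summit.Langlands.Langlands.Theorems.HostInducedRep.OneTransparentPane

/-- **Stub 1 (`stub_signPin`, the lever of line `one-transparent-pane`), registered signature VERBATIM,
from the named fact `Mok2014_archimedean_parity_of_asaiSign`** (Mok 2014: Thm. 2.4.10, Lemma 2.2.1,
Remark 2.2.2, Cor. 2.5.5 in coset form).  `E/F` quadratic with involution `c`, `P` cuspidal on
`GL_N(𝔸_E)`, `N ≥ 1`, conjugate self-dual a.e. with Asai sign `κ`, `σ` a `c`-fixed complex place: if
the archimedean exponents `χ σ` of `P` are multiplicity-free and lie in one real coset `r + ℤ`, then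
that coset is `(N-1)/2 + (1-κ)/4 + ℤ`.  Conditional on an unproved named fact (the endoscopic
classification); nothing else is used. [cite: Mok2014, Thm. 2.4.10, Lemma 2.2.1, Remark 2.2.2 and Cor. 2.5.5] -/
theorem stub_signPin_cond :
    Literature.NumberTheory.Automorphic.Mok2014_archimedean_parity_of_asaiSign →
    ∀ (F E : Type) [Field F] [NumberField F] [Field E] [NumberField E] [Algebra F E]
      (c : E ≃ₐ[F] E), Module.finrank F E = 2 → c ≠ 1 →
    ∀ (N : ℕ) (hcpt : isCompact_glFiniteIntegralLevel N E) (P : CuspidalAutomorphicRepData N E hcpt)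
      (κ : ℤˣ) (χ : (E →+* ℂ) → Multiset ℂ) (σ : E →+* ℂ) (r : ℝ),
      0 < N → P.1.IsConjSelfDualAE c → P.1.HasAsaiSign c κ → P.1.HasArchParameter χ →
      NumberField.ComplexEmbedding.IsConj σ c → (χ σ).Nodup →
      (∀ a ∈ χ σ, ∃ m : ℤ, a = (m : ℂ) + (r : ℂ)) →
      ∀ a ∈ χ σ, ∃ m : ℤ, a = (m : ℂ) + ((N : ℂ) - 1) / 2 + (1 - ((κ : ℤ) : ℂ)) / 4 :=
  fun h => h

end Summit.Langlands.Langlands.Theorems.HostInducedRep.OneTransparentPane
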